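import Summits.AtomisticToContinuum.HydrodynamicLimit.Theorems.OneFlightGossipEngineClampedCurrentsDockCutoff
import HarnessLib

/-!
# The re-orthogonalised low-speed heat-flux cut-off ALONG FAMILIES (stub
# `stub_loHeatFluxCutoffFamily`, line `IdeatorTwoSketch`, crux `ClampedCurrentsDock`,
# stmt-AtomisticToContinuum-14680)

Helper file (`--supports stmt-AtomisticToContinuum-14680`) proving the registered stub
`stub_loHeatFluxCutoffFamily : LoHeatFluxCutoffFamily` (S11-family) of the lead's skeleton
(`Cruxes/ClampedCurrentsDock/Lines/IdeatorTwoSketch.lean`). Yau's entropy ledger along a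
time-dependent local Gibbs reference feeds the kinetic window LD ONE family of class functionals
`F_s(x,v) = (b_s(x)·w) G_s(x,|w|²)`, `w = v − u₀(s,x)`, indexed by the window start `s`; it needs the
re-orthogonalised low-speed heat-flux cut-off of S11
(`ClampedCurrentsDockCutoff.stub_loHeatFluxCutoff`) built UNIFORMLY along the family: jointly
continuous in `(s, x, s′)`, one cut-off level `K⋆` for all `s`, bounds uniform in `s`.

Construction (the landed S11 construction with the parameter carried along; `cutoff_param` does it
over an arbitrary first-countable parameter space `X` in place of `𝕋³`, with GLOBAL bounds
`θm ≤ θ ≤ θM`, `‖u‖ ≤ U`, `‖b‖ ≤ Bb` as hypotheses replacing compactness):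
`G(p,s′) = (s′ − 5θ(p)) χ_L(s′) − ρ(p) r₀(s′/θ(p))` with `L = K⋆²`, the cutoff
`χ_L(s′) = min 1 (max 0 (2 − s′/L))`, the tent `r₀(t) = max 0 (1 − |t − (T₀+1)|)` above `T₀ = L/θm`,
`ρ = R/m₀` with `m₀ = E[ξ₀² r₀(‖ξ‖²)] > 0` and the truncated moment
`R(p) = E[ξ₀² (θ(p)‖ξ‖² − 5θ(p)) χ_L(θ(p)‖ξ‖²)]`, continuous in `p` by dominated convergence and
bounded UNIFORMLY in `p` by `(2L + 5θM) E[(1+‖ξ‖²)³]` (this replaces the compactness bound on `ρ` of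
S11). Orthogonality is pointwise in `p` (`ClampedCurrentsDockCutoff.odd_member_orth`). The family
statement is the case `X = ℝ × 𝕋³`, `θ = uncurry θ₀`.
-/

noncomputable section

namespace Summit.AtomisticToContinuum.HydrodynamicLimit.Theorems.ClampedCurrentsDockCutoffFamily

open MeasureTheory Filter Set Topology
open Literature.MathematicalPhysics.KineticTheory Literature.Analysis.FluidPDE Literature.Analysis.FunctionSpaces
open ProbabilityTheory
open Summit.AtomisticToContinuum.HydrodynamicLimit.Theorems.KineticCurrentsWindowLDUniformSketch.ClassTruncation
open Summit.AtomisticToContinuum.HydrodynamicLimit.Theorems.ClampedCurrentsDockCutoff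

/-! ## The statement -/

/-- registered stub signature S11-family of line IdeatorTwoSketch, crux ClampedCurrentsDock — route-internal,
not a cited fact -/
def LoHeatFluxCutoffFamily : Prop :=
  ∀ (θ₀ : ℝ → T3 → ℝ) (u₀ b : ℝ → T3 → V3), Continuous (Function.uncurry θ₀) →
    Continuous (Function.uncurry u₀) → Continuous (Function.uncurry b) →
    (∃ θm : ℝ, 0 < θm ∧ ∀ s x, θm ≤ θ₀ s x) → (∃ θM : ℝ, ∀ s x, θ₀ s x ≤ θM) →
    (∃ U : ℝ, ∀ s x, ‖u₀ s x‖ ≤ U) → (∃ Bb : ℝ, ∀ s x, ‖b s x‖ ≤ Bb) →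
    ∀ Kstar : ℝ, 0 < Kstar → ∃ G : ℝ → T3 × ℝ → ℝ, Continuous (Function.uncurry G) ∧
      (∃ C : ℝ, ∀ (s : ℝ) (y : T3 × ℝ), 0 ≤ y.2 → |G s y| ≤ C) ∧
      (∀ (s : ℝ) (x : T3) (s' : ℝ), s' ≤ Kstar ^ 2 → G s (x, s') = s' - 5 * θ₀ s x) ∧
      (∃ C : ℝ, ∀ (s : ℝ) (y : T3 × V3),
        |(∑ j : Fin 3, b s y.1 j * (y.2 - u₀ s y.1) j) * G s (y.1, ‖y.2 - u₀ s y.1‖ ^ 2)| ≤ C * (1 + ‖y.2‖ ^ 2)) ∧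
      (∀ s x, ∫ v, ((∑ j : Fin 3, b s x j * (v - u₀ s x) j) * G s (x, ‖v - u₀ s x‖ ^ 2)) *
        localMaxwellian 1 (θ₀ s x) (u₀ s x) v = 0) ∧
      (∀ s x (k : Fin 3), ∫ v, ((∑ j : Fin 3, b s x j * (v - u₀ s x) j) * G s (x, ‖v - u₀ s x‖ ^ 2)) * v k *
        localMaxwellian 1 (θ₀ s x) (u₀ s x) v = 0) ∧
      (∀ s x, ∫ v, ((∑ j : Fin 3, b s x j * (v - u₀ s x) j) * G s (x, ‖v - u₀ s x‖ ^ 2)) * ‖v‖ ^ 2 *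
        localMaxwellian 1 (θ₀ s x) (u₀ s x) v = 0)

/-! ## The construction over a parameter space -/

-- adapted from Summits/.../OneFlightGossipEngineClampedCurrentsDockCutoff.lean (`stub_loHeatFluxCutoff`)
/-- **The re-orthogonalised low-speed heat-flux cut-off over a first-countable parameter space.** For a
continuous `θ : X → ℝ` with global bounds `0 < θm ≤ θ ≤ θM`, fields `u b : X → V3` with `‖u‖ ≤ U`,
`‖b‖ ≤ Bb`, and a cut-off level `K⋆ > 0`, there is a continuous profile `G(p, s)`, bounded on `s ≥ 0`
uniformly in `p`, agreeing with `s − 5θ(p)` for `s ≤ K⋆²`, with `(b(p)·w) G(p,|w|²)`, `w = v − u(p)`,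
of quadratic growth uniformly in `p` and orthogonal to `1, v_k, ‖v‖²` under `M_{1,u(p),θ(p)}` at
every `p`. Construction `G(p,s) = (s − 5θ(p))χ_L(s) − ρ(p) r₀(s/θ(p))` (module docstring).
[folklore] -/
theorem cutoff_param {X : Type*} [TopologicalSpace X] [FirstCountableTopology X]
    {θ : X → ℝ} (hθc : Continuous θ) (u b : X → V3) {θm θM U Bb Kstar : ℝ}
    (hθm0 : 0 < θm) (hθm : ∀ p, θm ≤ θ p) (hθM0 : 0 < θM) (hθM : ∀ p, θ p ≤ θM)
    (hU : ∀ p, ‖u p‖ ≤ U) (hBb0 : 0 ≤ Bb) (hBb : ∀ p, ‖b p‖ ≤ Bb) (hK : 0 < Kstar) :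
    ∃ G : X × ℝ → ℝ, Continuous G ∧
      (∃ C : ℝ, ∀ y : X × ℝ, 0 ≤ y.2 → |G y| ≤ C) ∧
      (∀ (p : X) (s : ℝ), s ≤ Kstar ^ 2 → G (p, s) = s - 5 * θ p) ∧
      (∃ C : ℝ, ∀ (p : X) (v : V3),
        |(∑ j : Fin 3, b p j * (v - u p) j) * G (p, ‖v - u p‖ ^ 2)| ≤ C * (1 + ‖v‖ ^ 2)) ∧
      (∀ p, ∫ v, ((∑ j : Fin 3, b p j * (v - u p) j) * G (p, ‖v - u p‖ ^ 2)) *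
        localMaxwellian 1 (θ p) (u p) v = 0) ∧
      (∀ p (k : Fin 3), ∫ v, ((∑ j : Fin 3, b p j * (v - u p) j) * G (p, ‖v - u p‖ ^ 2)) * v k *
        localMaxwellian 1 (θ p) (u p) v = 0) ∧
      (∀ p, ∫ v, ((∑ j : Fin 3, b p j * (v - u p) j) * G (p, ‖v - u p‖ ^ 2)) * ‖v‖ ^ 2 *
        localMaxwellian 1 (θ p) (u p) v = 0) := by
  have hθpos : ∀ p, 0 < θ p := fun p => hθm0.trans_le (hθm p)
  /- Step 1: the cutoff `χ = χ_L`, `L = K⋆²`, and the tent `r₀` above `T₀ = L / θm`. -/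
  set L : ℝ := Kstar ^ 2 with hL
  have hL0 : 0 < L := pow_pos hK 2
  set χ : ℝ → ℝ := fun s => min 1 (max 0 (2 - s / L)) with hχ
  have hχlo : ∀ s, s ≤ L → χ s = 1 := cutoff_eq_one hL0 (χ := χ) fun s => by rw [hχ]
  obtain ⟨hχc, hχ0, hχ1, hχhi, -⟩ := cutoff_props hL0 (χ := χ) fun s => by rw [hχ]
  clear_value χ
  set T₀ : ℝ := L / θm with hT₀
  have hT₀0 : 0 < T₀ := div_pos hL0 hθm0
  set r₀ : ℝ → ℝ := fun t => max 0 (1 - |t - (T₀ + 1)|) with hr₀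
  obtain ⟨hr₀c, hr₀0, hr₀1, hr₀lo, hr₀hi, hr₀one⟩ := tent_props T₀ (r := r₀) fun t => by rw [hr₀]
  clear_value r₀
  have hr₀abs : ∀ t, 0 ≤ t → |r₀ t| ≤ 1 * (1 + t) := fun t ht =>
    le_mul_one_add (by rw [abs_of_nonneg (hr₀0 t)]; exact hr₀1 t) zero_le_one ht
  /- Step 2: the reference moment `m₀ = E[ξ₀² r₀(‖ξ‖²)] > 0`. -/
  have hir₀ : Integrable (fun ξ : V3 => ξ 0 * ξ 0 * r₀ (‖ξ‖ ^ 2)) (stdGaussian V3) :=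
    integrable_coord_mul_weight 0 0 hr₀c hr₀abs
  set m₀ : ℝ := ∫ ξ, ξ 0 * ξ 0 * r₀ (‖ξ‖ ^ 2) ∂stdGaussian V3 with hm₀def
  have hm₀ : 0 < m₀ := by
    haveI := isOpenPosMeasure_stdGaussian_V3
    have hpt : (EuclideanSpace.single (0 : Fin 3) (Real.sqrt (T₀ + 1)) : V3) 0 =
        Real.sqrt (T₀ + 1) := by
      simp
    have hn : ‖(EuclideanSpace.single (0 : Fin 3) (Real.sqrt (T₀ + 1)) : V3)‖ ^ 2 = T₀ + 1 := by
      rw [PiLp.norm_single, Real.norm_eq_abs, sq_abs, Real.sq_sqrt (by positivity)]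
    rw [hm₀def]
    refine integral_pos_of_integrable_nonneg_nonzero
      (x := (EuclideanSpace.single (0 : Fin 3) (Real.sqrt (T₀ + 1)) : V3)) (by fun_prop) hir₀
      (fun ξ => mul_nonneg (mul_self_nonneg _) (hr₀0 _)) ?_
    beta_reduce
    rw [hpt, hn, hr₀one, mul_one, Real.mul_self_sqrt (by positivity)]
    positivity
  clear_value m₀
  /- Step 3: the truncated profile is bounded; the truncated moment `R` (continuous by dominated
  convergence, bounded uniformly in the parameter) and the compensating amplitude `ρ = R/m₀`. -/
  have hq : ∀ p s, 0 ≤ s → |(s - 5 * θ p) * χ s| ≤ 2 * L + 5 * θM := by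
    intro p s hs
    by_cases h : s ≤ 2 * L
    · rw [abs_mul, abs_of_nonneg (hχ0 s)]
      calc |s - 5 * θ p| * χ s ≤ |s - 5 * θ p| * 1 :=
            mul_le_mul_of_nonneg_left (hχ1 s) (abs_nonneg _)
        _ ≤ 2 * L + 5 * θM := by
            rw [mul_one]
            refine (abs_sub _ _).trans ?_
            rw [abs_of_nonneg hs, abs_of_nonneg (by have := hθpos p; positivity)]
            linarith [hθM p]
    · rw [hχhi s (not_le.1 h).le, mul_zero, abs_zero]; positivity
  have hGM0 : 0 ≤ 2 * L + 5 * θM := by positivity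
  have hbd : ∀ (p : X) (ξ : V3),
      |ξ 0 * ξ 0 * ((θ p * ‖ξ‖ ^ 2 - 5 * θ p) * χ (θ p * ‖ξ‖ ^ 2))| ≤
        1 * 1 * (2 * L + 5 * θM) * (1 + ‖ξ‖ ^ 2) ^ 3 := fun p ξ =>
    abs_mul_three_le (abs_coord_le' ξ 0) (abs_coord_le' ξ 0)
      (le_mul_one_add (hq p _ (mul_nonneg (hθpos p).le (sq_nonneg _))) hGM0 (sq_nonneg _))
  set R : X → ℝ := fun p => ∫ ξ, ξ 0 * ξ 0 *
    ((θ p * ‖ξ‖ ^ 2 - 5 * θ p) * χ (θ p * ‖ξ‖ ^ 2)) ∂stdGaussian V3 with hR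
  have hRc : Continuous R := by
    refine continuous_of_dominated
      (bound := fun ξ : V3 => 1 * 1 * (2 * L + 5 * θM) * (1 + ‖ξ‖ ^ 2) ^ 3)
      (fun p => (by fun_prop : Continuous fun ξ : V3 => ξ 0 * ξ 0 *
        ((θ p * ‖ξ‖ ^ 2 - 5 * θ p) * χ (θ p * ‖ξ‖ ^ 2))).aestronglyMeasurable)
      (fun p => ae_of_all _ fun ξ => ?_) (integrable_one_add_norm_sq_cube.const_mul _)
      (ae_of_all _ fun ξ => by fun_prop)
    rw [Real.norm_eq_abs]
    exact hbd p ξ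
  set M₃ : ℝ := ∫ ξ : V3, (1 + ‖ξ‖ ^ 2) ^ 3 ∂stdGaussian V3 with hM₃
  have hM₃0 : 0 ≤ M₃ := integral_nonneg fun ξ => by positivity
  have hRbd : ∀ p, |R p| ≤ 1 * 1 * (2 * L + 5 * θM) * M₃ := by
    intro p
    have h := norm_integral_le_of_norm_le (μ := stdGaussian V3)
      (f := fun ξ : V3 => ξ 0 * ξ 0 * ((θ p * ‖ξ‖ ^ 2 - 5 * θ p) * χ (θ p * ‖ξ‖ ^ 2)))
      (integrable_one_add_norm_sq_cube.const_mul (1 * 1 * (2 * L + 5 * θM)))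
      (ae_of_all (stdGaussian V3) fun ξ => by rw [Real.norm_eq_abs]; exact hbd p ξ)
    rw [Real.norm_eq_abs, integral_const_mul] at h
    rw [hR]
    exact h
  set ρ : X → ℝ := fun p => R p / m₀ with hρ
  have hρc : Continuous ρ := by rw [hρ]; exact hRc.div_const _
  set ρM : ℝ := 1 * 1 * (2 * L + 5 * θM) * M₃ / m₀ with hρMdef
  have hρM0 : 0 ≤ ρM := by positivity
  have hρM : ∀ p, |ρ p| ≤ ρM := fun p => by
    rw [hρ, hρMdef]
    dsimp only
    rw [abs_div, abs_of_pos hm₀]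
    exact div_le_div_of_nonneg_right (hRbd p) hm₀.le
  clear_value R ρ ρM
  /- Step 4: the profile `G` and its pointwise properties. -/
  set G : X × ℝ → ℝ := fun q => (q.2 - 5 * θ q.1) * χ q.2 - ρ q.1 * r₀ (q.2 / θ q.1) with hG
  have hGc : Continuous G := by
    have hd : Continuous fun q : X × ℝ => q.2 / θ q.1 :=
      continuous_snd.div (hθc.comp continuous_fst) fun q => (hθpos q.1).ne'
    have h1 : Continuous fun q : X × ℝ => (q.2 - 5 * θ q.1) * χ q.2 := by fun_prop
    rw [hG]
    exact h1.sub ((hρc.comp continuous_fst).mul (hr₀c.comp hd))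
  have hGlo : ∀ p s, s ≤ L → G (p, s) = s - 5 * θ p := by
    intro p s hs
    have h1 : s / θ p ≤ T₀ := by
      rw [div_le_iff₀ (hθpos p)]
      calc s ≤ L := hs
        _ = T₀ * θm := by rw [hT₀, div_mul_cancel₀ _ hθm0.ne']
        _ ≤ T₀ * θ p := mul_le_mul_of_nonneg_left (hθm p) hT₀0.le
    simp only [hG]
    rw [hχlo s hs, hr₀lo _ h1]; ring
  set S₀ : ℝ := max (2 * L) ((T₀ + 2) * θM) with hS₀
  have hS₀0 : 0 ≤ S₀ := le_max_of_le_left (by positivity)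
  have hGhi : ∀ p s, S₀ ≤ s → G (p, s) = 0 := by
    intro p s hs
    have h1 : 2 * L ≤ s := (le_max_left _ _).trans hs
    have h2 : T₀ + 2 ≤ s / θ p := by
      rw [le_div_iff₀ (hθpos p)]
      calc (T₀ + 2) * θ p ≤ (T₀ + 2) * θM := mul_le_mul_of_nonneg_left (hθM p) (by positivity)
        _ ≤ S₀ := le_max_right _ _
        _ ≤ s := hs
    simp only [hG]
    rw [hχhi s h1, hr₀hi _ h2]; ring
  set CG : ℝ := 2 * L + 5 * θM + ρM with hCG
  have hCG0 : 0 ≤ CG := by rw [hCG]; positivity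
  have hGbd : ∀ p s, 0 ≤ s → |G (p, s)| ≤ CG := by
    intro p s hs
    simp only [hG]
    refine (abs_sub _ _).trans (add_le_add (hq p s hs) ?_)
    rw [abs_mul]
    exact (mul_le_mul (hρM p) (by rw [abs_of_nonneg (hr₀0 _)]; exact hr₀1 _) (abs_nonneg _)
      hρM0).trans (le_of_eq (mul_one _))
  /- Step 5: the scalar re-orthogonalisation identity `E[ξ₀² G(p, θ(p)‖ξ‖²)] = R − ρ m₀ = 0`. -/
  have hscalar : ∀ p, ∫ ξ : V3, ξ 0 * ξ 0 * G (p, θ p * ‖ξ‖ ^ 2) ∂stdGaussian V3 = 0 := by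
    intro p
    have hGsh : ∀ ξ : V3, ξ 0 * ξ 0 * G (p, θ p * ‖ξ‖ ^ 2) =
        ξ 0 * ξ 0 * ((θ p * ‖ξ‖ ^ 2 - 5 * θ p) * χ (θ p * ‖ξ‖ ^ 2)) -
          ρ p * (ξ 0 * ξ 0 * r₀ (‖ξ‖ ^ 2)) := by
      intro ξ; simp only [hG]; rw [mul_div_cancel_left₀ _ (hθpos p).ne']; ring
    have hi1 : Integrable (fun ξ : V3 => ξ 0 * ξ 0 *
        ((θ p * ‖ξ‖ ^ 2 - 5 * θ p) * χ (θ p * ‖ξ‖ ^ 2))) (stdGaussian V3) :=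
      integrable_coord_mul_weight 0 0 (ω := fun t => (θ p * t - 5 * θ p) * χ (θ p * t))
        (by fun_prop) (P := 2 * L + 5 * θM)
        (fun t ht => le_mul_one_add (hq p _ (mul_nonneg (hθpos p).le ht)) hGM0 ht)
    simp_rw [hGsh]
    rw [integral_sub hi1 (hir₀.const_mul _), integral_const_mul, ← hm₀def, hρ,
      div_mul_cancel₀ _ hm₀.ne', sub_eq_zero, hR]
  /- Step 6: assembly (growth of `F = (b·w)G`; orthogonality by `odd_member_orth`). -/
  have horth := fun p => odd_member_orth (hθpos p) (u p) (b p) (Gx := fun s => G (p, s))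
    (by fun_prop) (C := CG) (fun s hs => hGbd p s hs) hS₀0 (fun s hs => hGhi p s hs) (hscalar p)
  refine ⟨G, hGc, ⟨CG, fun y hy => hGbd y.1 y.2 hy⟩, hGlo, ⟨Bb * CG * (2 + 2 * U ^ 2), fun p v => ?_⟩,
    fun p => (horth p).1, fun p k => (horth p).2.1 k, fun p => (horth p).2.2⟩
  have h1 := abs_lin_le (b p) (v - u p)
  have h2 := hGbd p _ (sq_nonneg ‖v - u p‖)
  have hw : ‖v - u p‖ ^ 2 ≤ 2 * ‖v‖ ^ 2 + 2 * U ^ 2 := by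
    have h3 := norm_sub_le v (u p)
    have h4 : ‖u p‖ ^ 2 ≤ U ^ 2 := pow_le_pow_left₀ (norm_nonneg _) (hU p) 2
    nlinarith [norm_nonneg (v - u p), norm_nonneg v, norm_nonneg (u p), sq_nonneg (‖v‖ - ‖u p‖)]
  have h5 : 0 ≤ Bb * CG * (1 + 2 * U ^ 2 * ‖v‖ ^ 2) := by positivity
  rw [abs_mul]
  calc |∑ j, b p j * (v - u p) j| * |G (p, ‖v - u p‖ ^ 2)|
      ≤ ‖b p‖ * (1 + ‖v - u p‖ ^ 2) * CG := mul_le_mul h1 h2 (abs_nonneg _) (by positivity)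
    _ ≤ Bb * (1 + (2 * ‖v‖ ^ 2 + 2 * U ^ 2)) * CG := by gcongr; exact hBb p
    _ ≤ Bb * CG * (2 + 2 * U ^ 2) * (1 + ‖v‖ ^ 2) := by nlinarith [h5]

/-! ## The stub -/

/-- **S11-family `stub_loHeatFluxCutoffFamily`** (line `IdeatorTwoSketch`, crux
stmt-AtomisticToContinuum-14680): the re-orthogonalised low-speed heat-flux cut-off exists along
jointly continuous one-parameter families with global bounds — `cutoff_param` over the parameter
space `ℝ × 𝕋³` with `θ = uncurry θ₀`, `u = uncurry u₀`, `b = uncurry b`, re-curried. [folklore] -/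
theorem stub_loHeatFluxCutoffFamily : LoHeatFluxCutoffFamily := by
  rintro θ₀ u₀ b hθc - - ⟨θm, hθm0, hθm⟩ ⟨θM, hθM⟩ ⟨U, hU⟩ ⟨Bb, hBb⟩ Kstar hK
  have hθM0 : 0 < θM := hθm0.trans_le ((hθm 0 0).trans (hθM 0 0))
  have hBb0 : 0 ≤ Bb := (norm_nonneg _).trans (hBb 0 0)
  obtain ⟨G, hGc, ⟨C, hC⟩, hGlo, ⟨C', hC'⟩, h0, h1, h2⟩ :=
    cutoff_param (X := ℝ × T3) (θ := Function.uncurry θ₀) hθc (Function.uncurry u₀)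
      (Function.uncurry b) hθm0 (fun p => hθm p.1 p.2) hθM0 (fun p => hθM p.1 p.2)
      (fun p => hU p.1 p.2) hBb0 (fun p => hBb p.1 p.2) hK
  refine ⟨fun s y => G ((s, y.1), y.2), ?_, ⟨C, fun s y hy => hC ((s, y.1), y.2) hy⟩,
    fun s x s' hs' => hGlo (s, x) s' hs', ⟨C', fun s y => hC' (s, y.1) y.2⟩,
    fun s x => h0 (s, x), fun s x k => h1 (s, x) k, fun s x => h2 (s, x)⟩
  show Continuous fun q : ℝ × (T3 × ℝ) => G ((q.1, q.2.1), q.2.2)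
  fun_prop

end Summit.AtomisticToContinuum.HydrodynamicLimit.Theorems.ClampedCurrentsDockCutoffFamily

end
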